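import Summits.AnomalousDissipation.AnomalousDissipation.Theses.LimitingAbsorption
import Summits.AnomalousDissipation.AnomalousDissipation.Theorems.LimitingAbsorptionRelaxationBoundsInventory

/-!
# Disproof of `RelaxationBoundsInventory` — findings: NO KILL POSSIBLE, the crux is a THEOREM

cdisprove cycle 1 (refuter-cdisprove-stmt-AnomalousDissipation-2940-0, 2026-08-16).

* STATUS. Item `stmt-AnomalousDissipation-2940` was CLOSED `proved` at 2026-08-16T10:42:39Z by
  `Summit.AnomalousDissipation.AnomalousDissipation.Theorems.relaxationBoundsInventory_proof`
  (proposal p96697, ACCEPTED, commit e45ab5f9b83e, axioms = {propext, Classical.choice, Quot.sound};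
  line `Sketch`, all five stubs landed: p96240 eLpNormDecay, p96294 RiemannSource,
  p96331 SliceBoundTransfer, p96351 ForcedOfWeakIdentity, p96354 LongTimeAvgSupOfAe).
  Hence `¬ RelaxationBoundsInventory` is itself refutable (`not_refutable` below) and no
  counterexample search, junk-model instantiation or hypothesis mutation can produce a kill of the
  crux AS STATED. The disprover seat has nothing left to attack on this item; no `Negative/` lemma
  is worth prover time on a closed routine crux (rank 9, "provable now" per grounders g20-36/g25-50/g25-40).

* WHY IT RESISTED (for the record; matches the pre-attack reading of the signature).
  - No junk escape in the conclusion: `longTimeAvgSup` junk (unbounded means ↦ `sInf ∅ = 0`) and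
    `scalarL2Sq` junk (non-L² slice ↦ 0) both LOWER the left-hand side; `4 * C / γ ^ 2 * scalarL2Sq h ≥ 0`.
  - No junk escape in the hypotheses: `(U_h)` quantifies over the tree's weak class
    `Torus.IsWeakScalarTransportOn` (L^∞_t L²_x), for which existence (`exists_isWeakScalarTransportOn_holds`)
    and bounded-drift uniqueness (`KinematicSteadySourceLaw.forced_ae_eq_of_memLp_top`) are in tree, so the
    sourced solution IS the Duhamel superposition a.e. and Minkowski applies; only `L^∞` drift is used
    (no div-free, no Lipschitz), exactly the item's hypothesis.
  - Degenerate corners are consistent, not false: `C = 0` or `C < 1` force `h = 0` a.e. through weak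
    continuity at the datum (then the conclusion reads `limsup-mean ‖θ‖² ≤ 0`, true by uniqueness from the
    zero datum with zero source); `h` with non-zero mean makes `(U_h)` unsatisfiable (mean is conserved),
    i.e. vacuous there, never false.

* TIGHTNESS (informal, not needed by anyone downstream but worth knowing for the route's energy budget
  `meanEnergy(u_j) ≤ E + 4C‖h‖²/γ²` in `ScalarSectorLift`): the constant `4C/γ²` is SHARP already for pure
  diffusion. Take `u = 0`, `h` a Laplace eigenfunction, `-Δh = λh` (`λ = 4π²|k|²`). Every weak solution of the
  homogeneous problem from datum `h` is `e^{-κλt} h` (uniqueness), so `(U_h)` holds with `C = 1`, `γ = 2κλ`,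
  from every phase. The sourced solution from zero datum is `θ(t) = (1 - e^{-κλt})/(κλ) · h`, whose
  `limsup`-mean of `‖θ(t)‖²` is `‖h‖²/(κλ)² = 4C‖h‖²/γ²` — equality. So no `Negative/` "constant cannot
  improve" lemma changes anything for the provers: the Duhamel–Minkowski constant is the truth.

* LOAD-BEARING HYPOTHESES (paper analysis only; no Lean `_false_without_` lemmas filed — the item is
  closed and such lemmas would not inform any remaining proof).
  - `0 < γ`: load-bearing even literally. Dropping it admits `γ = 0`, where `(U_h)` reads
    `‖Θ(t)‖² ≤ C‖h‖²` (true with `C = 1` for `u = 0` by L²-contraction) while the conclusion becomes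
    `limsup-mean ‖θ‖² ≤ 4C/0^2·‖h‖² = 0` (Lean junk `x/0 = 0`), false for the heat example above
    (inventory `‖h‖²/(κλ)² > 0`). Witness: `u = 0`, `h = cos(2πx₁)`, `C = 1`, `γ = 0`.
  - phase-uniformity (`∀ s ≥ 0` in `(U_h)`): load-bearing (heuristic witness, fixed small `κ`): stage 1,
    `t ∈ [0,1]`: shear `(A sin 2πx₂, 0)` with `2πA` tuned near the first zero of `J₀` so that the
    `x₂`-average of `S(1,0)h`, `h = cos 2πx₁`, vanishes exactly; stage 2, `t ≥ 1`: shear `(0, sin 2πx₁)`,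
    which preserves the `x₂`-Fourier index `m`, dissipates every `m ≠ 0` mode at the enhanced rate
    `r(κ) ≳ κ^{1/2} ≫ κ`, but leaves a FRESH copy of `h(x₁)` invariant up to pure diffusion. Then `(U_h)` from
    phase 0 holds with `γ = r(κ)`, `C = O(1)`, whereas releases from phases `s ≥ 1` pile up to the diffusive
    inventory `‖h‖²/(4π²κ)² ≫ 4C/r(κ)²` for `κ` small: the phase-0-only statement is false. So the `(U_h)`
    clause of `UniformRelaxationWitness` / `RelaxingFamily` cannot be weakened to phase `0` without losing
    the inventory (information for planners, not for this closed item).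
  - `0 < κ` and local boundedness of `u`: used only through existence + uniqueness of the weak class
    (`exists_isWeakScalarTransportOn_holds`, `forced_ae_eq_of_memLp_top`); whether the statement survives for
    `u ∈ L²_t L²_x` drifts (possibly non-unique weak scalars) is open and irrelevant to the route (the NS
    velocities of `UniformRelaxationWitness` are assumed locally bounded).
  - `MemLp h 2`: without it `scalarL2Sq h` is junk `0` and `(U_h)` forces every release to vanish, so the
    hypothesis side degenerates consistently (no weak solution has a non-L² datum trace); not a falsity lever.
-/

namespace Summit.AnomalousDissipation.AnomalousDissipation.Cruxes.RelaxationBoundsInventory.Disproof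

open Summit.AnomalousDissipation.AnomalousDissipation.Theses.LimitingAbsorption

/-- The crux holds (re-export of the landed proof, p96697): any purported disproof is inconsistent. -/
theorem crux_holds : RelaxationBoundsInventory :=
  Summit.AnomalousDissipation.AnomalousDissipation.Theorems.relaxationBoundsInventory_proof

/-- `¬ RelaxationBoundsInventory` is refutable: the disprover's target is closed for good. -/
theorem not_refutable : ¬ ¬ RelaxationBoundsInventory := fun h => h crux_holds

end Summit.AnomalousDissipation.AnomalousDissipation.Cruxes.RelaxationBoundsInventory.Disproof
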